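import Literature.NumberTheory.Sieve.FriedlanderIwaniecPrimesCrudeBound
import HarnessLib

/-!
# Friedlander–Iwaniec, *The polynomial `X² + Y⁴` captures its primes*: the expected main term `M_d(x)` and Lemma 3.1

Family `parity`, statement parity.S17. Source: J. Friedlander, H. Iwaniec, Ann. of Math. (2) 148
(1998), 945–1040 [FriedlanderIwaniecAnnals1998], §3: (3.1) and the displays following it
(`A_d(x)`, `M_d(x)`, `ρ(b; d)`), Lemma 3.1 with (3.3), the Remarks after it, (3.4)–(3.5).

FI §3 considers `a_n = Σ_{a² + b² = n} 𝔷(b)` ((3.1); for Theorem 1, `𝔷(b) = #{c ∈ ℤ : c² = b}`,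
(3.14), so that `a_n = #{(a, c) : a² + c⁴ = n}` = the tree's `fiRepCount`), the congruence sums
`A_d(x) = Σ_{0 < a²+b² ≤ x, d ∣ a²+b²} 𝔷(b)` (= `fiSieveSeq.congrSum d x`) and "expect that `A_d(x)`
is well approximated by

  `M_d(x) = d⁻¹ Σ_{0 < a² + b² ≤ x} 𝔷(b) ρ(b; d)`,

where `ρ(b; d)` denotes the number of solutions `α (mod d)` to `α² + b² ≡ 0 (mod d)`"
(= `sqCongrCount d (-b²)` of `FriedlanderIwaniecPrimesCrudeBound`). With `𝔷` as in (3.14) this is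

  `M_d(x) = d⁻¹ Σ_{(a, c) ∈ ℤ², 0 < a² + c⁴ ≤ x} ρ(c²; d)`  (`fiMainTerm`).

**Lemma 3.1** (the harmonic-analysis input of Proposition 3.5, "a modification of Lemma 4 of [FI]"
= Fouvry–Iwaniec, *Gaussian primes*, Acta Arith. 79 (1997), proved in §3 from Lemmas 3.2–3.3 by
Poisson summation): "Suppose `𝔷(b)` is supported on squares and `|𝔷(b)| ≤ 2`. Then
(3.3) `Σ_{d ≤ D} |A_d(x) - M_d(x)| ≪ D^{1/4} x^{9/16+ε}` for any `D ≥ 1` and `ε > 0`, the implied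
constant depending only on `ε`." It is vendored here, for the `𝔷` of (3.14) (supported on squares,
values in `{0, 1, 2}`), as the named fact `FriedlanderIwaniec1998_lemma31` (uniformly in `x ≥ 1`:
for bounded `x` both sides are bounded, (3.4)–(3.5), so this is the printed statement with its
constant). Proposition 3.5 (`FriedlanderIwaniec1998_prop35`) is Lemma 3.1 combined with Lemma 3.4
(the evaluation `M_d(x) = 4κ g(d) x^{3/4} + O(h(d) x^{1/2})` for cubefree `d`; the factor `4` of
(3.18) is missing in the display (3.15) as printed) — the subject of a sequel; this file only fixes
the definitions.

## Contents

* `fiMainTerm d x` (`M_d(x)`), `fiMainTerm_def`, `fiMainTerm_nonneg`, `fiMainTerm_zero_left`;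
* `FriedlanderIwaniec1998_lemma31` (named fact, FI Lemma 3.1 (3.3)).

## References

* J. Friedlander, H. Iwaniec, *The polynomial `X² + Y⁴` captures its primes*, Ann. of Math. (2)
  148 (1998), 945–1040, §3: (3.1)–(3.5), Lemma 3.1. [cite: FriedlanderIwaniecAnnals1998, §3, Lemma 3.1 (3.3)]
* E. Fouvry, H. Iwaniec, *Gaussian primes*, Acta Arith. 79 (1997), 249–287, Lemma 4 (the result
  Lemma 3.1 modifies; cited by FI as [FI]).

## Mathlib / tree

Tree: `fiPoints`, `fiQuartic`, `fiSieveSeq` (`FriedlanderIwaniecPrimes`), `sqCongrCount`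
(`FriedlanderIwaniecPrimesCrudeBound`). No Mathlib notion of this main term exists
(`lean search 'MainTerm|mainTerm'` in the FI files: nothing relevant).
-/

noncomputable section

open Filter Finset Real

namespace Literature.NumberTheory.Sieve

open FriedlanderIwaniecPrimes

/-- FI's expected main term for `A_d(x)`:
`M_d(x) = d⁻¹ Σ_{0 < a² + b² ≤ x} 𝔷(b) ρ(b; d) = d⁻¹ Σ_{(a,c) : 0 < a² + c⁴ ≤ x} ρ(c²; d)` with
`ρ(b; d) = #{α mod d : α² + b² ≡ 0 (mod d)}` (`sqCongrCount d (-b²)`), for the sequence (3.1) with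
`𝔷(b) = #{c : c² = b}` (3.14). (`M_0(x) = 0`.)
[cite: FriedlanderIwaniecAnnals1998, §3, display defining M_d(x) after (3.1)] -/
def fiMainTerm (d : ℕ) (x : ℝ) : ℝ :=
  (∑ ac ∈ fiPoints ⌊x⌋₊, (sqCongrCount d (-(ac.2) ^ 4) : ℝ)) / d

/-- `fiMainTerm` unfolded. [cite: FriedlanderIwaniecAnnals1998, §3, display defining M_d(x) after (3.1)] -/
theorem fiMainTerm_def (d : ℕ) (x : ℝ) :
    fiMainTerm d x = (∑ ac ∈ fiPoints ⌊x⌋₊, (sqCongrCount d (-(ac.2) ^ 4) : ℝ)) / d := rfl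

/-- `M_d(x) ≥ 0`. [folklore] -/
theorem fiMainTerm_nonneg (d : ℕ) (x : ℝ) : 0 ≤ fiMainTerm d x :=
  div_nonneg (Finset.sum_nonneg fun _ _ => Nat.cast_nonneg _) (Nat.cast_nonneg _)

/-- `M_0(x) = 0` (junk modulus). [folklore] -/
theorem fiMainTerm_zero_left (x : ℝ) : fiMainTerm 0 x = 0 := by simp [fiMainTerm]

/-- `M_1(x) = #{(a, c) : 0 < a² + c⁴ ≤ x} = A(x)` (`ρ(b; 1) = 1`).
[cite: FriedlanderIwaniecAnnals1998, §3, (3.1)] -/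
theorem fiMainTerm_one (x : ℝ) : fiMainTerm 1 x = #(fiPoints ⌊x⌋₊) := by
  rw [fiMainTerm, Nat.cast_one, div_one, Finset.card_eq_sum_ones, Nat.cast_sum]
  refine Finset.sum_congr rfl fun ac _ => ?_
  simp [sqCongrCount]

/-- **FI Lemma 3.1** (for the sequence (3.1) with `𝔷(b) = #{c : c² = b}`, i.e.
`a_n = #{(a, c) : a² + c⁴ = n}`): for every `ε > 0` there is `K = K(ε)` with
(3.3) `Σ_{1 ≤ d ≤ D} |A_d(x) - M_d(x)| ≤ K D^{1/4} x^{9/16 + ε}` for all `D ≥ 1` and `x ≥ 1`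
("for any `D ≥ 1` and `ε > 0`, the implied constant depending only on `ε`"; the hypotheses of the
printed lemma — `𝔷` supported on squares, `|𝔷| ≤ 2` — hold for this `𝔷`). Proved in FI §3 from
Lemma 3.2 (a large sieve for the roots of `ν² + 1 ≡ 0 (mod d)`), Lemma 3.3 and Poisson summation;
"a modification of Lemma 4 of [FI]" (Fouvry–Iwaniec). Not proved here.
[cite: FriedlanderIwaniecAnnals1998, Lemma 3.1 (3.3)] -/
def FriedlanderIwaniec1998_lemma31 : Prop :=
  ∀ ε : ℝ, 0 < ε → ∃ K : ℝ, ∀ x : ℝ, 1 ≤ x → ∀ D : ℝ, 1 ≤ D →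
    ∑ d ∈ Icc 1 ⌊D⌋₊, |fiSieveSeq.congrSum d x - fiMainTerm d x| ≤
      K * D ^ (1 / 4 : ℝ) * x ^ (9 / 16 + ε : ℝ)

end Literature.NumberTheory.Sieve
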